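import Literature.MathematicalPhysics.QuantumFieldTheory.Balaban1983to89.B2Eq337LastIntegrations

/-!
# `Balaban1983to89.B2Ineq335Exceptions` — T. Bałaban, *(Higgs)₂,₃ quantum fields in a finite volume. II. An upper
bound*, Commun. Math. Phys. **86** (1982) 555–594 [Balaban1982Higgs2], §3.B pp. 590–591: **«(3.22) ⇒ (3.35)»** — the
step *"we can integrate with some exceptions … using the normalization properties of the renormalization
transformations (3.32) … The exceptions are when we integrate over φ_{k+1}(y) with the points y ∈ P_s⁽ᵏ⁾ … (3.33)
Thus, defining the functions ζ′_{Λ₀⁽ᵏ⁾} (3.34) we get the inequality (3.35)"* PROVED as a kernel theorem on r14's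
schematic chain of levels (`B2Eq337LastIntegrations.chainDensity`): TOP-DOWN INTEGRATION OF SUB-PROBABILITY LEVEL
KERNELS (§1) and THE ASSEMBLY over the sums of admissible families with the pointwise step (3.30)–(3.31) (§2); file 1/2
(file 2/2 `B2Ineq335Printed`: the Gaussian renormalization kernels with the printed large-field exceptions, (3.33)
site by site, the pointwise step from Prop. 3.1 (3.26), and (3.35) in the printed letters)

statement-level skeleton of published theorems with citation tags; proofs where landed; nothing here is a claim about the Yang–Mills mass gap

CITATION HEADER.  PDF held `paper:balaban1982-cmp86-higgs23-ii` (journal page = PDF page + 554); pp. 588–591 READ AS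
IMAGES on the ×2 renders `run/shared/lean/pub/pub-balaban/b2b-balaban-ref1/pages/1982-cmp86-higgs23-II/1982-cmp86-higgs23-II-p034-x2.png`
… `-p037-x2.png`.  Unit `lit-balaban-p15` gen 6 (Phase-2 proof seat p15; HOME `run/shared/lean/pub/lit-balaban/`).
SKELETON row **B2.Eq3.32** ((3.30)–(3.41); fold owner r02, second readers r14/r13, referee ref-4; head `proved p246000`):
its residue member **(3.35)** was «absent — enters as hypothesis-shape only» (`h335` of r14's
`B2Eq337LastIntegrations.ineq339_of_335_338` and of this seat's gen-4 `B2Ineq339Gathering.ineq339`/`ineq339_knit`;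
GAPS G-B2-07 (vi)).  RELATED TREE RESULTS USED BY NAME: r14 g5 `B2Eq337LastIntegrations.chainDensity` /
`lmarginal_chainDensity` (the EQUALITY case: probability kernels, (3.36) = (3.37)); r14 g3 `B2Sect3BSmallFactors.ineq330`
/ `ineq331` / `ineq333` ((3.30), (3.31), (3.33) as one-line / one-site kernels) — consumed in file 2/2.  Nothing of those
files is restated; r14's `private` measurability lemma for `chainDensity` is re-proved here (privately) because this
file needs it.

THE SOURCE TEXT (verbatim, p. 590 l.−12 – p. 591 l.8 [PDF 36–37]).  *"We use Proposition 3.1 and we obtain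
Z(Ã^ε)exp(−½⟨Φ, Δ(Ã^ε)Φ⟩) ≦ Z(Ã^ε)exp(−¼⟨Φ, Δ(Ã^ε)Φ⟩)·exp(−¼(the right side of (3.26))). (3.30)  Now we estimate the
characteristic functions by 1, except the functions ζ_{Λ₀⁽ᵏ⁾}. These contain the functions χᶜ_{Q_s⁽ᵏ⁾}, which give the
restrictions of the form (Lᵏε)^{d−2}|U(Ã^ε(⟨x,x′⟩))φ_k(x′) − φ_k(x)|² > p(Lᵏε)² for all the bonds ⟨x,x′⟩ ∈ Q_s⁽ᵏ⁾. The
bonds of this set are contained in Λ₇⁽ᵏ⁻¹⁾′ ∩ Λ₀⁽ᵏ⁾ᶜ ⊂ Λ₅⁽ᵏ⁻¹⁾′ ∩ Λ₅⁽ᵏ⁾ᶜ, hence χᶜ_{Q_s⁽ᵏ⁾} exp(−¼(kᵗʰ term of the right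
side of (3.26))) ≦ exp(−¼γ₀p(Lᵏε)²|Q_s⁽ᵏ⁾| + O((Lᵏε)^{κ₀})|Λ_k|). (3.31)  Further, because there are no characteristic
functions on the right side of (3.22) except the functions remaining in ζ_{Λ₀⁽ᵏ⁾}, so we can integrate with some
exceptions, with respect to the fields φ_K↾_{Λ₅⁽ᴷ⁻¹⁾′ᶜ}, φ_{K−1}↾_{Λ₅⁽ᴷ⁻²⁾′ᶜ}, …, φ₁↾_{Λ₅⁽⁰⁾′ᶜ}, using the normalization
properties of the renormalization transformations ∫dφ_{k+l}(y) t^{Lᵏε}_{a_l,L^l,A}(φ_{k+l}(y), φ_k↾_{B^l(y)}) = 1. (3.32)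
The exceptions are when we integrate over φ_{k+1}(y) with the points y ∈ P_s⁽ᵏ⁾. In this case the characteristic
functions χᶜ_{P_s⁽ᵏ⁾} give the restrictions (Lᵏε)^{d−2}|φ_{k+1}(y) − (Q(Ã^ε)φ_k)(y)|² > p(Lᵏε)², and instead of the
integral (3.32) we have ∫dφ_{k+1}(y) χ({…}) (a(Lᵏε)^{d−2}/2π)^{N/2} exp[−½a(Lᵏε)^{d−2}|φ_{k+1}(y) − (Q(Ã^ε)φ_k)(y)|²] ≦
2^{N/2} exp(−¼ap(Lᵏε)²) ≦ exp(−⅛ap(Lᵏε)²). (3.33)  Thus, defining the functions ζ′_{Λ₀⁽ᵏ⁾} = Σ_{{P_v⁽ᵏ⁾,…,R_s⁽ᵏ⁾}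
admissible, minimal} χᶜ_{P_v⁽ᵏ⁾}·χᶜ_{Q_v⁽ᵏ⁾}χᶜ_{R_v⁽ᵏ⁾} exp(−⅛ap(Lᵏε)²|P_s⁽ᵏ⁾|)·exp(−¼γ₀p(Lᵏε)²|Q_s⁽ᵏ⁾|)
exp(−p(Lᵏε)²|R_s⁽ᵏ⁾|), (3.34) we get the inequality (the right side of (3.22)) ≦ ∫dΦ Z(Ã^ε)·exp(−¼⟨Φ, Δ(Ã^ε)Φ⟩)
Π_{k=0}^{K−1} ζ′_{Λ₀⁽ᵏ⁾} · exp Σ_{k=1}^{K} O((Lᵏε)^{κ₀})|Λ_k|. (3.35)  The functions ζ′_{Λ₀⁽ᵏ⁾} depend on the vector fields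
only."*  The structure integrated, (3.22) p. 588: `{…} = ∫dφ_K T^{L^{K−1}ε}_{a,L,Ã^{(K−1)},ε}(Λ₅⁽ᴷ⁻¹⁾ᶜ) ⋯ T^ε_{a,L,Ã^ε}(Λ₅⁽⁰⁾ᶜ)
[χ_{K,s}ζ_{Λ₀⁽ᴷ⁻¹⁾}χ_{K−1,Λ₅⁽ᴷ⁻¹⁾ᶜ,s}χ_{Λ₋₁⁽ᴷ⁻¹⁾∩Λ₅⁽ᴷ⁻¹⁾ᶜ,s} ⋯ ζ_{Λ₀⁽⁰⁾}χ_{Λ₋₁⁽⁰⁾∩Λ₅⁽⁰⁾ᶜ,s} · (Π_{k=1}^{K}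
T^ε_{a_k,Lᵏ,Ã^ε}(Bᵏ(Λ₅⁽ᵏ⁻¹⁾′∩Λ₅⁽ᵏ⁾ᶜ))) · [exp(−½⟨φ₀, (−Δ^ε_{Ã^ε} + m²)φ₀⟩)]]]`, whose part right of the characteristic
functions is `Z(Ã^ε)exp(−½⟨Φ, Δ(Ã^ε)Φ⟩)` by (3.25), `Φ` = (3.24) the fields on `Λ₅⁽⁰⁾ᶜ ∪ ⋃_{k≥1}(Λ₅⁽ᵏ⁻¹⁾′∩Λ₅⁽ᵏ⁾ᶜ)`;
the functions ζ, (2.15) p. 559: `ζ_{Λ₀} = Σ_{{P_v,…,R_s} admissible, minimal for Λ₀} χᶜ_{P_v}χᶜ_{Q_v}·χᶜ_{R_v}χᶜ_{P_s}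
χᶜ_{Q_s}exp(−p(ε)²|R_s|)`.

THE MODEL (schematic, = r14's chain of `B2Eq337LastIntegrations` with one change of reading).  Levels `i = 0, 1, …`
with configuration spaces `X i` and σ-finite measures `μ i`: `X 0` ↤ the KEPT variables `Φ` of (3.24) (the fields
`φ₀↾_{Λ₅⁽⁰⁾ᶜ}`, `φ_k↾_{Λ_k}`, `Λ_k = Λ₅⁽ᵏ⁻¹⁾′∩Λ₅⁽ᵏ⁾ᶜ`, which (3.35) still integrates: `∫dΦ`); `X (j+1)` ↤ the OUTPUT
field `φ_{j+1}↾_{Λ₅⁽ʲ⁾ᶜ′}` of the outer one-step transformation `T^{Lʲε}_{a,L,Ã^{(j)}}(Λ₅⁽ʲ⁾ᶜ)` of (3.22), i.e. exactly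
the variables the text integrates *"with respect to the fields φ_K↾_{Λ₅⁽ᴷ⁻¹⁾′ᶜ}, …, φ₁↾_{Λ₅⁽⁰⁾′ᶜ}"* (`Λ₅⁽ʲ⁾ᶜ =
Λ₅⁽ʲ⁻¹⁾ᶜ′ ⊔ Λ_j`: the domain of `φ_j` splits into its output part and its kept part).  The kernel `k j` of level
`j+1` ↤ the kernel `Π_{y∈Λ₅⁽ʲ⁾ᶜ′} t(φ_{j+1}(y), φ_j↾_{B(y)})` of that transformation (reads the levels `≤ j+1`; its
inputs `φ_j↾_{B(y)}` live in `X j` and `X 0`).  A tuple of families `τ = (τ_j)_{j<K}` ↤ one admissible minimal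
family `{P_v⁽ʲ⁾,…,R_s⁽ʲ⁾}` per level `j = 0, …, K−1` (the product `Π_j ζ_{Λ₀⁽ʲ⁾}` of sums expanded); per family:
`w_{j,τ} ∈ [0,∞]` ↤ `χᶜ_{P_v}χᶜ_{Q_v}χᶜ_{R_v}·exp(−p(Lʲε)²|R_s|)` (constant in the scalar fields — p. 588 *"treating the
configuration Ã^ε as a fixed external field"*), `q_{j,τ} : X 0 → [0,∞]` ↤ `χᶜ_{Q_s⁽ʲ⁾}` (reads `φ_j` on the bonds of
`Λ_j`, i.e. KEPT variables only — the printed sentence *"The bonds of this set are contained in … Λ₅⁽ᵏ⁻¹⁾′∩Λ₅⁽ᵏ⁾ᶜ"*),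
`e_{j,τ}` ↤ `χᶜ_{P_s⁽ʲ⁾}` (reads the output field `φ_{j+1}` at the points of `P_s⁽ʲ⁾` and the history); `B ∈ [0,1]`
↤ the product of all the other characteristic functions (`χ_{K,s}`, `χ_{k,Λ₅⁽ᵏ⁾ᶜ,s}`, `χ_{Λ₋₁⁽ᵏ⁾∩Λ₅⁽ᵏ⁾ᶜ,s}`), *"estimated
by 1"* (any dependence); `F : X 0 → [0,∞]` ↤ `Z(Ã^ε)exp(−½⟨Φ,Δ(Ã^ε)Φ⟩)`, `F₄` ↤ `Z(Ã^ε)exp(−¼⟨Φ,Δ(Ã^ε)Φ⟩)`.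

WHAT IS PROVED (kernel-checked, 0 `sorry`, standard axioms).
§1 `lintegral_chainDensity_update_le` (one level: a kernel of mass `≤ θ_K` in its output
   variable integrates away leaving the factor `θ_K`); **`lmarginal_chainDensity_le`**: for level kernels `k_j` reading
   the levels `≤ j+1` and of mass `≤ θ_j` for every history (`j < K`), `∫⋯∫_{levels 0…K} g(x₀)Π_{j<K}k_j ≤
   (Π_{j<K}θ_j)·∫g dμ₀` — r14's `lmarginal_chainDensity` is the case `θ ≡ 1` of probability kernels, with equality;
   the text's TOP-DOWN order *"φ_K↾ first, …, φ₁↾ last"* is the induction (Tonelli, Mathlib `lmarginal_insert'`).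
§2 `integrand322` / `rhs322` (the schematic right side of (3.22) above, two plumbing defs), `kernelOfFamilies`
   (`k_j·e_{j,τ_j}`); **`rhs322_le`**: IF (pointwise step) for every tuple `τ` and every
   configuration `F(x₀)·B(x)·Π_j q_{j,τ_j}(x₀) ≤ C·F₄(x₀)·Π_j σ_{j,τ_j}` (↤ (3.30) from Prop. 3.1 on the support of the
   characteristic functions, then (3.31), then *"estimate the characteristic functions by 1"*; `σ_{j,τ} =
   e^{−¼γ₀p(Lʲε)²|Q_s⁽ʲ⁾|}`, `C = exp ΣO((Lᵏε)^{κ₀})|Λ_k|`) AND (integration with exceptions) each `k_j·e_{j,τ}` has mass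
   `≤ θ_{j,τ}` in the output variable for every history (↤ (3.32) at the ordinary sites, (3.33) at the sites of
   `P_s⁽ʲ⁾`: `θ_{j,τ} = (e^{−⅛ap(Lʲε)²})^{|P_s⁽ʲ⁾|}`), THEN `rhs322 ≤ C · ∫F₄ dμ₀ · Π_{j<K} Σ_τ w_{j,τ}σ_{j,τ}θ_{j,τ}` — (3.35)
   with **ζ′_j = Σ_τ w_{j,τ}σ_{j,τ}θ_{j,τ} = (3.34)**.  Proof = expand `Π_jΣ_τ` (`Fintype.prod_sum`), bound each tuple's
   integrand pointwise, exchange the finite sum with the integrals, §1 per tuple, re-fold.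
Both hypotheses of `rhs322_le` are DISCHARGED for the Gaussian renormalization kernels and the printed large-field
exceptions in file 2/2 (`B2Ineq335Printed.ineq335`), from Prop. 3.1 (3.26) and `4N log 2 ≤ a p(Lʲε)²` alone.
HONEST SCOPE.  (i) SCHEMATIC, as r14's (3.37): the theorem is about the integration structure the text describes —
one normalized kernel per output variable, read top-down, characteristic functions of the three kinds above — not
about the concrete sets (3.21)–(3.24) of the (Higgs)₂,₃ carrier; that the paper's (3.22) has this structure is the
dictionary (in particular that `χᶜ_{Q_s⁽ʲ⁾}` reads kept variables only is the quoted sentence of p. 590, and that each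
`χᶜ_{P_s⁽ʲ⁾}` concerns output variables of level j+1 is the quoted sentence *"The exceptions are when we integrate over
φ_{k+1}(y) with the points y ∈ P_s⁽ᵏ⁾"*).  (ii) The composition step (3.21) → (3.22) (*"we compose the renormalization
transformations localized in the sets …"*) is NOT reproduced; nor is (3.40) (vector fields).  (iii) The gen-4 concrete
chain `B2Ineq339Gathering.ineq339_knit` keeps its `h335` hypothesis: there `lhs` is a free real standing for the
concrete `{…}`, whose definition needs (ii).  (iv) `[0,∞]`-valued (Tonelli) form throughout; the weights `w` may be
any constants in `[0,∞]`.  Value = kernel certificate of the published integration-with-exceptions step in schematic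
coordinates; NOT summit progress.
-/

noncomputable section

namespace Literature.MathematicalPhysics.QuantumFieldTheory.Balaban1983to89.B2Ineq335Exceptions

open MeasureTheory Finset Function
open scoped ENNReal
open B2Eq337LastIntegrations (chainDensity)

/-! ## §1  Sub-probability level kernels: the top-down integration INEQUALITY -/

section General

variable {X : ℕ → Type*} [∀ i, MeasurableSpace (X i)]

/-- measurability of r14's integrand `g(x₀)·Π_{j<K} k_j(x)` (the corresponding lemma of
`B2Eq337LastIntegrations` is private). [folklore] -/
private theorem measurable_chainDensity {g : X 0 → ℝ≥0∞} (hg : Measurable g)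
    {k : ℕ → (∀ i, X i) → ℝ≥0∞} (hk : ∀ j, Measurable (k j)) (K : ℕ) :
    Measurable (chainDensity g k K) :=
  (hg.comp (measurable_pi_apply 0)).mul (Finset.measurable_prod _ fun j _ => hk j)

variable (μ : ∀ i, Measure (X i))

/-- ONE LEVEL, INEQUALITY FORM of *"we use (3.32)"*: if the level-(K+1) kernel has mass `≤ θ_K` in the
level-(K+1) variable for every history (↤ (3.32) at the ordinary sites, (3.33) at the exceptional sites
`y ∈ P_s⁽ᴷ⁾`), then integrating the level K+1 out of `g(x₀)Π_{j<K+1}k_j` leaves at most `θ_K · g(x₀)Π_{j<K}k_j`.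
[cite: Balaban1982Higgs2, (3.32)–(3.33) p.590 (mechanism)] -/
theorem lintegral_chainDensity_update_le (g : X 0 → ℝ≥0∞) {k : ℕ → (∀ i, X i) → ℝ≥0∞}
    (hk : ∀ j, Measurable (k j))
    (hdep : ∀ j i, j + 1 < i → ∀ (x : ∀ i, X i) (y : X i), k j (update x i y) = k j x)
    {θ : ℕ → ℝ≥0∞} {K : ℕ} (hsub : ∀ x : ∀ i, X i, ∫⁻ y, k K (update x (K + 1) y) ∂μ (K + 1) ≤ θ K)
    (x : ∀ i, X i) :
    ∫⁻ y, chainDensity g k (K + 1) (update x (K + 1) y) ∂μ (K + 1) ≤ chainDensity g k K x * θ K := by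
  have h1 : ∀ y, chainDensity g k (K + 1) (update x (K + 1) y)
      = chainDensity g k K x * k K (update x (K + 1) y) := by
    intro y
    simp only [chainDensity]
    rw [Function.update_of_ne (by omega : (0 : ℕ) ≠ K + 1), Finset.prod_range_succ]
    have hp : ∏ j ∈ range K, k j (update x (K + 1) y) = ∏ j ∈ range K, k j x :=
      Finset.prod_congr rfl fun j hj => hdep j (K + 1) (by rw [Finset.mem_range] at hj; omega) x y
    rw [hp, mul_assoc]
  simp_rw [h1]
  have hm : Measurable (fun y : X (K + 1) => k K (update x (K + 1) y)) :=
    (hk K).comp (measurable_update x)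
  rw [lintegral_const_mul _ hm]
  exact mul_le_mul' le_rfl (hsub x)

variable [∀ i, SigmaFinite (μ i)]

/-- **THE INTEGRATION WITH EXCEPTIONS** (mechanism of «(3.22) ⇒ (3.35)», p. 590 *"we can integrate with some
exceptions … The exceptions are when we integrate over φ_{k+1}(y) with the points y ∈ P_s⁽ᵏ⁾ … instead of the
integral (3.32) we have … ≦ exp(−⅛ap(Lᵏε)²). (3.33)"*): for an `ℕ`-indexed chain of σ-finite levels, a
measurable weight `g ≥ 0` at level 0 and measurable level kernels `k_j` reading only the levels `≤ j+1`, each of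
MASS AT MOST `θ_j` in the level-(j+1) variable for every history (`j < K`), integrating out the levels `0, …, K`
of `g(x₀)·Π_{j<K}k_j(x)` gives at most `(Π_{j<K}θ_j)·∫g dμ₀` — induction on `K`, the top level first
(r14's `lmarginal_chainDensity` is the case of probability kernels, `θ ≡ 1` with equality).
[cite: Balaban1982Higgs2, (3.32)–(3.35) pp.590–591 (mechanism)] -/
theorem lmarginal_chainDensity_le {g : X 0 → ℝ≥0∞} (hg : Measurable g) {k : ℕ → (∀ i, X i) → ℝ≥0∞}
    (hk : ∀ j, Measurable (k j))
    (hdep : ∀ j i, j + 1 < i → ∀ (x : ∀ i, X i) (y : X i), k j (update x i y) = k j x)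
    {θ : ℕ → ℝ≥0∞} {K : ℕ}
    (hsub : ∀ j, j < K → ∀ x : ∀ i, X i, ∫⁻ y, k j (update x (j + 1) y) ∂μ (j + 1) ≤ θ j)
    (x : ∀ i, X i) :
    (∫⋯∫⁻_range (K + 1), chainDensity g k K ∂μ) x ≤ (∏ j ∈ range K, θ j) * ∫⁻ y, g y ∂μ 0 := by
  induction K generalizing x with
  | zero =>
    rw [zero_add, Finset.range_one, lmarginal_singleton]
    simp [chainDensity]
  | succ K ih =>
    rw [Finset.range_add_one,
      lmarginal_insert' _ (measurable_chainDensity hg hk (K + 1)) notMem_range_self]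
    have hK : ∀ x : ∀ i, X i, ∫⁻ y, k K (update x (K + 1) y) ∂μ (K + 1) ≤ θ K :=
      hsub K (Nat.lt_succ_self K)
    have ih' : ∀ x : ∀ i, X i,
        (∫⋯∫⁻_range (K + 1), chainDensity g k K ∂μ) x ≤ (∏ j ∈ range K, θ j) * ∫⁻ y, g y ∂μ 0 :=
      fun x => ih (fun j hj => hsub j (Nat.lt_succ_of_lt hj)) x
    calc (∫⋯∫⁻_range (K + 1),
            (fun x => ∫⁻ y, chainDensity g k (K + 1) (update x (K + 1) y) ∂μ (K + 1)) ∂μ) x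
        ≤ (∫⋯∫⁻_range (K + 1), (fun x => chainDensity g k K x * θ K) ∂μ) x :=
          lmarginal_mono (fun x => lintegral_chainDensity_update_le μ g hk hdep hK x) x
      _ = (∫⋯∫⁻_range (K + 1), chainDensity g k K ∂μ) x * θ K := by
          simp only [lmarginal]
          rw [lintegral_mul_const]
          exact (measurable_chainDensity hg hk K).comp measurable_updateFinset
      _ ≤ ((∏ j ∈ range K, θ j) * ∫⁻ y, g y ∂μ 0) * θ K := mul_le_mul' (ih' x) le_rfl
      _ = (∏ j ∈ range (K + 1), θ j) * ∫⁻ y, g y ∂μ 0 := by rw [Finset.prod_range_succ]; ring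

end General

/-! ## §2  «(3.22) ⇒ (3.35)»: the families, the pointwise step (3.30)–(3.31), the integration with exceptions,
and the functions ζ′ (3.34) -/

section Assembly

variable {X : ℕ → Type*} [∀ i, MeasurableSpace (X i)] (μ : ∀ i, Measure (X i)) [∀ i, SigmaFinite (μ i)]
variable {K : ℕ} {ι : Fin K → Type*} [∀ j, Fintype (ι j)]

/-- **THE UNDERINTEGRAL EXPRESSION OF THE RIGHT SIDE OF (3.22)** after (3.25), SCHEMATIC: `F(Φ)` (↤
`Z(Ã^ε)exp(−½⟨Φ,Δ(Ã^ε)Φ⟩)`, reads the kept variables `Φ = x₀`) `· B(x)` (↤ the product of the characteristic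
functions `χ_{K,s}, χ_{k,Λ₅⁽ᵏ⁾ᶜ,s}, χ_{Λ₋₁⁽ᵏ⁾∩Λ₅⁽ᵏ⁾ᶜ,s}` of (3.22) which are *"estimated by 1"*, values in `[0,1]`)
`· Π_{j<K} k_j(x)` (↤ the one-step renormalization kernels `T^{Lʲε}_{a,L,Ã^{(j)}}(Λ₅⁽ʲ⁾ᶜ)` producing the OUTPUT
fields `φ_{j+1}↾_{Λ₅⁽ʲ⁾ᶜ′} = x_{j+1}`) `· Π_{j<K} Σ_{τ ∈ ι_j} w_{j,τ}·q_{j,τ}(x₀)·e_{j,τ}(x)` (↤ the functions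
`ζ_{Λ₀⁽ʲ⁾} = Σ_{{P_v,…,R_s} admissible, minimal} χᶜ_{P_v}χᶜ_{Q_v}χᶜ_{R_v}·χᶜ_{P_s}χᶜ_{Q_s}exp(−p(Lʲε)²|R_s|)` of
(2.15)/(3.22): `τ` ↤ an admissible minimal family at level j, `w_{j,τ}` ↤ `χᶜ_{P_v}χᶜ_{Q_v}χᶜ_{R_v}exp(−p²|R_s|)`
(constants: the vector fields are fixed, p. 588), `q_{j,τ}` ↤ `χᶜ_{Q_s⁽ʲ⁾}` (reads `φ_j↾_{Λ_j} ⊂ Φ`, p. 590 *"The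
bonds of this set are contained in … Λ₅⁽ʲ⁻¹⁾′∩Λ₅⁽ʲ⁾ᶜ"*), `e_{j,τ}` ↤ `χᶜ_{P_s⁽ʲ⁾}` (reads the output field
`φ_{j+1}` and the history)). [cite: Balaban1982Higgs2, (3.22) p.588 with (3.25) p.589 and (2.15) p.559, dictionary] -/
def integrand322 (F : X 0 → ℝ≥0∞) (B : (∀ i, X i) → ℝ≥0∞) (k : ℕ → (∀ i, X i) → ℝ≥0∞)
    (w : (j : Fin K) → ι j → ℝ≥0∞) (q : (j : Fin K) → ι j → X 0 → ℝ≥0∞)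
    (e : (j : Fin K) → ι j → (∀ i, X i) → ℝ≥0∞) (x : ∀ i, X i) : ℝ≥0∞ :=
  F (x 0) * B x * (∏ j ∈ range K, k j x) * ∏ j : Fin K, ∑ τ : ι j, w j τ * q j τ (x 0) * e j τ x

/-- **THE RIGHT SIDE OF (3.22)**, SCHEMATIC: the integral of `integrand322` over all the levels `x₀ = Φ` (kept
variables), `x₁, …, x_K` (output fields). [cite: Balaban1982Higgs2, (3.22) p.588, dictionary] -/
def rhs322 (F : X 0 → ℝ≥0∞) (B : (∀ i, X i) → ℝ≥0∞) (k : ℕ → (∀ i, X i) → ℝ≥0∞)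
    (w : (j : Fin K) → ι j → ℝ≥0∞) (q : (j : Fin K) → ι j → X 0 → ℝ≥0∞)
    (e : (j : Fin K) → ι j → (∀ i, X i) → ℝ≥0∞) (x : ∀ i, X i) : ℝ≥0∞ :=
  (∫⋯∫⁻_range (K + 1), integrand322 F B k w q e ∂μ) x

/-- the kernel of a FIXED TUPLE OF FAMILIES `τ = (τ_j)_{j<K}`: `k_j · e_{j,τ_j}` at the levels `j < K`, `k_j`
above. [cite: Balaban1982Higgs2, (3.22)/(3.33) pp.588–590, dictionary] -/
def kernelOfFamilies (k : ℕ → (∀ i, X i) → ℝ≥0∞) (e : (j : Fin K) → ι j → (∀ i, X i) → ℝ≥0∞)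
    (τ : ∀ j, ι j) (j : ℕ) (x : ∀ i, X i) : ℝ≥0∞ :=
  k j x * (if h : j < K then e ⟨j, h⟩ (τ ⟨j, h⟩) x else 1)

variable {μ}

omit [(i : ℕ) → MeasurableSpace (X i)] [∀ i, SigmaFinite (μ i)] [∀ j, Fintype (ι j)] in
/-- `Π_{j<K}(k_j e_{j,τ_j}) = (Π_{j<K}k_j)·(Π_{j<K}e_{j,τ_j})`. [folklore] -/
private theorem prod_kernelOfFamilies (k : ℕ → (∀ i, X i) → ℝ≥0∞) (e : (j : Fin K) → ι j → (∀ i, X i) → ℝ≥0∞)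
    (τ : ∀ j, ι j) (x : ∀ i, X i) :
    ∏ j ∈ range K, kernelOfFamilies k e τ j x = (∏ j ∈ range K, k j x) * ∏ j : Fin K, e j (τ j) x := by
  unfold kernelOfFamilies
  rw [Finset.prod_mul_distrib, ← Fin.prod_univ_eq_prod_range (fun j => if h : j < K then _ else _) K]
  congr 1
  exact Finset.prod_congr rfl fun j _ => by simp [j.2]

/-- **«(3.22) ⇒ (3.35)»**, SCHEMATIC (p. 590 l.−19 – p. 591 l.8): suppose
* (pointwise step, ↤ (3.30) from Prop. 3.1 on the support of the characteristic functions, then (3.31) for each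
  `χᶜ_{Q_s⁽ʲ⁾}`, then *"we estimate the characteristic functions by 1"*) for every tuple of families `τ` and every
  configuration: `F(x₀)·B(x)·Π_j q_{j,τ_j}(x₀) ≤ C·F₄(x₀)·Π_j σ_{j,τ_j}` (↤ `F₄ = Z(Ã^ε)exp(−¼⟨Φ,Δ(Ã^ε)Φ⟩)`, `σ_{j,τ} =
  exp(−¼γ₀p(Lʲε)²|Q_s⁽ʲ⁾|)`, `C = exp Σ_{k=1}^{K}O((Lᵏε)^{κ₀})|Λ_k|`);
* (integration with exceptions, ↤ (3.32) at the ordinary sites and (3.33) at the sites of `P_s⁽ʲ⁾`) the kernel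
  `k_j` times the exception factor `e_{j,τ}` has mass `≤ θ_{j,τ}` in the output variable `x_{j+1}` for every
  history (↤ `θ_{j,τ} = exp(−⅛ap(Lʲε)²|P_s⁽ʲ⁾|)`), the kernels and exception factors reading only the levels `≤ j+1`;
then `(the right side of (3.22)) ≤ C · ∫dΦ F₄(Φ) · Π_{j<K} ζ′_j` with **`ζ′_j = Σ_τ w_{j,τ}·σ_{j,τ}·θ_{j,τ}`** — the
functions (3.34) `ζ′_{Λ₀⁽ʲ⁾} = Σ χᶜ_{P_v}χᶜ_{Q_v}χᶜ_{R_v} exp(−⅛ap(Lʲε)²|P_s⁽ʲ⁾|) exp(−¼γ₀p(Lʲε)²|Q_s⁽ʲ⁾|)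
exp(−p(Lʲε)²|R_s⁽ʲ⁾|)` — i.e. (3.35).  Proof: expand the product of the family sums (`Fintype.prod_sum`), bound
each tuple's integrand pointwise, integrate top-down with `lmarginal_chainDensity_le`, re-fold the sums.
[cite: Balaban1982Higgs2, (3.30)–(3.35) pp.590–591] -/
theorem rhs322_le {F F4 : X 0 → ℝ≥0∞} (hF4 : Measurable F4) {B : (∀ i, X i) → ℝ≥0∞}
    {k : ℕ → (∀ i, X i) → ℝ≥0∞} (hk : ∀ j, Measurable (k j))
    (hdep : ∀ j i, j + 1 < i → ∀ (x : ∀ i, X i) (y : X i), k j (update x i y) = k j x)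
    {w σ θ : (j : Fin K) → ι j → ℝ≥0∞} {q : (j : Fin K) → ι j → X 0 → ℝ≥0∞}
    {e : (j : Fin K) → ι j → (∀ i, X i) → ℝ≥0∞} (he : ∀ j τ, Measurable (e j τ))
    (hedep : ∀ (j : Fin K) τ i, (j : ℕ) + 1 < i → ∀ (x : ∀ i, X i) (y : X i), e j τ (update x i y) = e j τ x)
    (hexc : ∀ (j : Fin K) τ (x : ∀ i, X i),
      ∫⁻ y, k j (update x ((j : ℕ) + 1) y) * e j τ (update x ((j : ℕ) + 1) y) ∂μ ((j : ℕ) + 1) ≤ θ j τ)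
    {C : ℝ≥0∞}
    (hpt : ∀ (τ : ∀ j, ι j) (x : ∀ i, X i),
      F (x 0) * B x * ∏ j, q j (τ j) (x 0) ≤ C * F4 (x 0) * ∏ j, σ j (τ j))
    (x : ∀ i, X i) :
    rhs322 μ F B k w q e x ≤ C * (∫⁻ u, F4 u ∂μ 0) * ∏ j : Fin K, ∑ τ : ι j, w j τ * σ j τ * θ j τ := by
  classical
  -- the constant of a tuple and its kernel
  set cst : (∀ j, ι j) → ℝ≥0∞ := fun τ => C * ∏ j, w j (τ j) * σ j (τ j) with hcst
  -- (A) pointwise: integrand ≤ Σ_τ cst τ · chainDensity F4 (k·e_τ)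
  have hA : ∀ x : ∀ i, X i, integrand322 F B k w q e x
      ≤ ∑ τ : ∀ j, ι j, cst τ * chainDensity F4 (kernelOfFamilies k e τ) K x := by
    intro x
    unfold integrand322
    rw [Fintype.prod_sum (fun j τ => w j τ * q j τ (x 0) * e j τ x), Finset.mul_sum]
    refine Finset.sum_le_sum fun τ _ => ?_
    simp only [chainDensity, prod_kernelOfFamilies, Finset.prod_mul_distrib, hcst]
    -- F B Pk (Pw Pq Pe) ≤ (C Pw Pσ) (F4 (Pk Pe))
    have h := hpt τ x
    calc F (x 0) * B x * (∏ j ∈ range K, k j x) * ((∏ j, w j (τ j)) * (∏ j, q j (τ j) (x 0)) * ∏ j, e j (τ j) x)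
        = (F (x 0) * B x * ∏ j, q j (τ j) (x 0)) * ((∏ j, w j (τ j)) * ((∏ j ∈ range K, k j x) * ∏ j, e j (τ j) x)) := by
          ring
      _ ≤ (C * F4 (x 0) * ∏ j, σ j (τ j)) * ((∏ j, w j (τ j)) * ((∏ j ∈ range K, k j x) * ∏ j, e j (τ j) x)) :=
          mul_le_mul' h le_rfl
      _ = C * ((∏ j, w j (τ j)) * ∏ j, σ j (τ j)) * (F4 (x 0) * ((∏ j ∈ range K, k j x) * ∏ j, e j (τ j) x)) := by
          ring
  -- (B) the kernels of a tuple: measurable, local, of mass ≤ θ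
  have hkm : ∀ τ j, Measurable (kernelOfFamilies k e τ j) := by
    intro τ j
    unfold kernelOfFamilies
    by_cases h : j < K
    · simp only [h, dif_pos]; exact (hk j).mul (he _ _)
    · simp only [h, dif_neg, not_false_eq_true, mul_one]; exact hk j
  have hkdep : ∀ τ j i, j + 1 < i → ∀ (x : ∀ i, X i) (y : X i),
      kernelOfFamilies k e τ j (update x i y) = kernelOfFamilies k e τ j x := by
    intro τ j i hji x y
    unfold kernelOfFamilies
    rw [hdep j i hji x y]
    by_cases h : j < K
    · simp only [h, dif_pos]; rw [hedep ⟨j, h⟩ (τ ⟨j, h⟩) i hji x y]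
    · simp only [h, dif_neg, not_false_eq_true]
  set θτ : (∀ j, ι j) → ℕ → ℝ≥0∞ := fun τ j => if h : j < K then θ ⟨j, h⟩ (τ ⟨j, h⟩) else 1 with hθτ
  have hksub : ∀ τ j, j < K → ∀ x : ∀ i, X i,
      ∫⁻ y, kernelOfFamilies k e τ j (update x (j + 1) y) ∂μ (j + 1) ≤ θτ τ j := by
    intro τ j hj x
    simp only [kernelOfFamilies, hθτ, hj, dif_pos]
    exact hexc ⟨j, hj⟩ (τ ⟨j, hj⟩) x
  have hθprod : ∀ τ : ∀ j, ι j, ∏ j ∈ range K, θτ τ j = ∏ j : Fin K, θ j (τ j) := by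
    intro τ
    rw [← Fin.prod_univ_eq_prod_range (fun j => θτ τ j) K]
    exact Finset.prod_congr rfl fun j _ => by simp [hθτ, j.2]
  -- (C) integrate
  have hmeas : ∀ τ, Measurable (fun x => cst τ * chainDensity F4 (kernelOfFamilies k e τ) K x) :=
    fun τ => (measurable_chainDensity hF4 (hkm τ) K).const_mul _
  calc rhs322 μ F B k w q e x
      ≤ (∫⋯∫⁻_range (K + 1),
          (fun x => ∑ τ : ∀ j, ι j, cst τ * chainDensity F4 (kernelOfFamilies k e τ) K x) ∂μ) x :=
        lmarginal_mono hA x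
    _ = ∑ τ : ∀ j, ι j, cst τ * (∫⋯∫⁻_range (K + 1), chainDensity F4 (kernelOfFamilies k e τ) K ∂μ) x := by
        simp only [lmarginal]
        rw [lintegral_finsetSum]
        · refine Finset.sum_congr rfl fun τ _ => ?_
          rw [lintegral_const_mul]
          exact (measurable_chainDensity hF4 (hkm τ) K).comp measurable_updateFinset
        · exact fun τ _ => (hmeas τ).comp measurable_updateFinset
    _ ≤ ∑ τ : ∀ j, ι j, cst τ * ((∏ j ∈ range K, θτ τ j) * ∫⁻ u, F4 u ∂μ 0) :=
        Finset.sum_le_sum fun τ _ => mul_le_mul' le_rfl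
          (lmarginal_chainDensity_le μ hF4 (hkm τ) (hkdep τ) (hksub τ) x)
    _ = C * (∫⁻ u, F4 u ∂μ 0) * ∑ τ : ∀ j, ι j, ∏ j, w j (τ j) * σ j (τ j) * θ j (τ j) := by
        rw [Finset.mul_sum]
        refine Finset.sum_congr rfl fun τ _ => ?_
        rw [hθprod, Finset.prod_mul_distrib (f := fun j => w j (τ j) * σ j (τ j))]
        simp only [hcst]
        ring
    _ = C * (∫⁻ u, F4 u ∂μ 0) * ∏ j : Fin K, ∑ τ : ι j, w j τ * σ j τ * θ j τ := by
        rw [Fintype.prod_sum (fun j τ => w j τ * σ j τ * θ j τ)]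

end Assembly

end Literature.MathematicalPhysics.QuantumFieldTheory.Balaban1983to89.B2Ineq335Exceptions

end
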